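import Mathlib.LinearAlgebra.Matrix.Adjugate
import Mathlib.LinearAlgebra.Matrix.Determinant.Basic
import Mathlib.Data.Real.Basic
import HarnessLib

/-!
# `StokesGeneration` (stmt-KontsevichZagierPeriods-3586) — line `fibrewise_stokes`,
# stub `stub_adjugate_mulVec_face`

Registered pure-matrix stub K2 (rung 15, change of variables for a face-preserving self-map of the
closed cube) of the line `fibrewise_stokes` of the crux `StokesGeneration` (route UnfoldedStokes).

On a face `{x_j = c}` of the cube the block `A = (1 - t) I + t DΦ` of the Jacobian matrix of the
suspension `F (x, t) = ((1 - t) x + t Φ x, t)` has row `j` proportional to `e_j`, and the column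
`v = Φ x - x` has `v j = 0`; the stub says that then the `j`-th entry of `adj(A) v` vanishes, so
the `x_j`-face terms of the Piola elements drop out.

Proof: `∑ k, adj(A) j k * v k = (adj(A) *ᵥ v) j = cramer A v j = det (A.updateCol j v)`
(`Matrix.cramer_eq_adjugate_mulVec`, `Matrix.cramer_apply`), and row `j` of `A.updateCol j v` is
zero: its `j`-th entry is `v j = 0` and its other entries are `A j k = 0` (`k ≠ j`); conclude with
`Matrix.det_eq_zero_of_row_eq_zero`.

References: M. Kontsevich, D. Zagier, *Periods* (2001), §1.2 (rule (2), change of variables);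
Cramer's rule / adjugate (Mathlib `Mathlib.LinearAlgebra.Matrix.Adjugate`).
-/

noncomputable section

-- `Summit.KontsevichZagierPeriods.KontsevichZagierPeriods.…` is the tree's mandated layout (single-conjunct summit).
set_option linter.dupNamespace false

namespace Summit.KontsevichZagierPeriods.KontsevichZagierPeriods.Cruxes.StokesGeneration.FibrewiseStokes

open Matrix

/-- **Registered stub `stub_adjugate_mulVec_face` (rung 15, K2).** If row `j` of a square matrix `A`
vanishes off the diagonal and `v j = 0`, then the `j`-th entry of `adj(A) v` vanishes:
`∑ k, adj(A) j k * v k = det (A with column j replaced by v) = 0`, the latter matrix having zero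
`j`-th row. [folklore] -/
theorem stub_adjugate_mulVec_face {N : ℕ} (A : Matrix (Fin N) (Fin N) ℝ) (j : Fin N)
    (hrow : ∀ k, k ≠ j → A j k = 0) (v : Fin N → ℝ) (hv : v j = 0) :
    ∑ k, A.adjugate j k * v k = 0 := by
  have h1 : ∑ k, A.adjugate j k * v k = (A.adjugate *ᵥ v) j := rfl
  rw [h1, ← cramer_eq_adjugate_mulVec, cramer_apply]
  refine det_eq_zero_of_row_eq_zero j fun k => ?_
  rw [updateCol_apply]
  split_ifs with hk
  · exact hv
  · exact hrow k hk

end Summit.KontsevichZagierPeriods.KontsevichZagierPeriods.Cruxes.StokesGeneration.FibrewiseStokes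

end
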